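import Summits.KontsevichZagierPeriods.KontsevichZagierPeriods.Theorems.LinRedNormalFormArrangementNormalFormSeparateTwoHIRay

/-!
# The Taylor pieces on one thin sector: the three ray theorems (main statements)

(Line `janus-bands`, crux `ArrangementNormalForm`, stub `stub_separateTwoPos_hI`, part
`HIRayMain`.) See part `HIRay` for the setting (weight `wt = ofReal (phi) · Λ'` on a thin sector
in blown-up coordinates, numerator `F(t, u) = ∑ κ im t^{i+m} u^{π im}`, `u = s + σ v`). This
file proves the three ray theorems: `ray_pole_zero` (`s = 0`), `ray_pole_order` (`s ≠ 0`,
registered as `separateTwo_hiRay`) and `ray_away` (no explicit powers: the weight itself is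
integrable near the corner).
-/

noncomputable section

open Set MeasureTheory
open scoped ENNReal

namespace Summit.KontsevichZagierPeriods.ArrangementNormalForm.JanusBands

namespace SepTwo

/-- Iterated set integrals of finite sums. -/
theorem lintegral₂_finset_sum {ι : Type*} (S : Finset ι) (f : ι → ℝ → ℝ → ℝ≥0∞)
    (hf : ∀ i ∈ S, Measurable (Function.uncurry (f i))) (A B : Set ℝ) :
    ∫⁻ t in A, ∫⁻ v in B, ∑ i ∈ S, f i t v = ∑ i ∈ S, ∫⁻ t in A, ∫⁻ v in B, f i t v := by
  have h1 : ∀ t, ∫⁻ v in B, ∑ i ∈ S, f i t v = ∑ i ∈ S, ∫⁻ v in B, f i t v := fun t =>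
    lintegral_finsetSum' S fun i hi => ((hf i hi).of_uncurry_left).aemeasurable
  simp_rw [h1]
  exact lintegral_finsetSum' S fun i hi => ((hf i hi).lintegral_prod_right').aemeasurable

/-- The matrix form of the finiteness hypothesis. -/
theorem hfin_cmat (T : Finset (ℕ × ℕ)) (κ : ℕ × ℕ → ℝ) (π : ℕ × ℕ → ℕ) (d : ℕ)
    (hdeg : ∀ im ∈ T, im.1 + im.2 ≤ d) (hπ : ∀ im ∈ T, π im ≤ d) (s σ : ℝ)
    (W : ℝ → ℝ → ℝ≥0∞) (A B : Set ℝ)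
    (hfin : ∫⁻ t in A, ∫⁻ v in B, ENNReal.ofReal |usum T κ π t (s + σ * v)| * W t v < ∞) :
    ∫⁻ t in A, ∫⁻ v in B, ENNReal.ofReal |∑ a : Fin (d + 1), ∑ b : Fin (d + 1),
      cmat T κ π s σ d a b * t ^ (a : ℕ) * v ^ (b : ℕ)| * W t v < ∞ := by
  have h : ∀ t v, ∑ a : Fin (d + 1), ∑ b : Fin (d + 1),
      cmat T κ π s σ d a b * t ^ (a : ℕ) * v ^ (b : ℕ) = usum T κ π t (s + σ * v) :=
    fun t v => (usum_eq_cmat T κ π d hdeg hπ s σ t v).symm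
  simp_rw [h]
  exact hfin

/-- A side `σ = ±1` is non-zero. -/
theorem sigma_ne_zero {σ : ℝ} (hσ : |σ| = 1) : σ ≠ 0 := fun h => by
  rw [h, abs_zero] at hσ; exact zero_ne_one hσ

/-- **Ray theorem at the pole / letter direction (`s = 0`).** -/
theorem ray_pole_zero (T : Finset (ℕ × ℕ)) (κ : ℕ × ℕ → ℝ) (π : ℕ × ℕ → ℕ) (d : ℕ)
    (hdeg : ∀ im ∈ T, im.1 + im.2 ≤ d) (hπ : ∀ im ∈ T, π im ≤ d)
    (hinj : ∀ im ∈ T, ∀ im' ∈ T, im.1 + im.2 = im'.1 + im'.2 → π im = π im' → im = im')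
    (D M : ℕ) {σ : ℝ} (hσ : |σ| = 1) {ω : ℝ → ℝ → ℝ} (hωm : Measurable (Function.uncurry ω))
    {Λ' : ℝ → ℝ → ℝ≥0∞} (hΛm : Measurable (Function.uncurry Λ')) {δ ε : ℝ}
    {ωlo ωhi : ℝ} (hωlo : 0 < ωlo)
    (hω : ∀ t ∈ Ioo (0 : ℝ) (4 * δ), ∀ v ∈ Ioo (0 : ℝ) (4 * ε), ωlo ≤ ω t v ∧ ω t v ≤ ωhi)
    (KΛ : ℝ≥0∞) (hKΛ : KΛ ≠ ∞)
    (hΛmono : ∀ x v x' v', 0 < x → x ≤ x' → x' ≤ 4 * x → x' < 4 * δ → 0 < v → v ≤ v' →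
      v' ≤ 4 * v → v' < 4 * ε → Λ' x v ≤ KΛ * Λ' x' v')
    (hfin : ∫⁻ t in Ioo 0 (4 * δ), ∫⁻ v in Ioo 0 (4 * ε),
      ENNReal.ofReal |usum T κ π t (0 + σ * v)| * wt D M 0 σ ω Λ' t v < ∞) (i : ℕ) :
    ∫⁻ t in Ioo 0 δ, ∫⁻ v in Ioo 0 ε, ENNReal.ofReal |usum (T.filter fun im => im.1 = i) κ π t
      (0 + σ * v)| * wt D M 0 σ ω Λ' t v < ∞ := by
  classical
  set W := wt D M 0 σ ω Λ' with hW
  have hWm : Measurable (Function.uncurry W) := measurable_wt D M 0 σ hωm hΛm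
  have hmono := wt_mono D M hσ (Or.inr (Or.inl rfl)) hωlo hω KΛ hΛmono (Λ' := Λ')
  set K := ENNReal.ofReal (4 ^ D * 4 ^ M * (ωhi / ωlo)) * KΛ with hK
  have hKne : K ≠ ∞ := ENNReal.mul_ne_top ENNReal.ofReal_ne_top hKΛ
  have hfin' := hfin_cmat T κ π d hdeg hπ 0 σ W _ _ hfin
  set Ti := T.filter fun im => im.1 = i with hTi
  -- every monomial of a non-zero term is integrable
  have hmon : ∀ im ∈ Ti, ENNReal.ofReal |κ im| * ∫⁻ t in Ioo 0 δ, ∫⁻ v in Ioo 0 ε,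
      ENNReal.ofReal (t ^ (im.1 + im.2) * v ^ (π im)) * W t v < ∞ := by
    intro im him
    have himT : im ∈ T := (Finset.mem_filter.1 him).1
    by_cases hk : κ im = 0
    · rw [hk, abs_zero, ENNReal.ofReal_zero, zero_mul]; exact ENNReal.zero_lt_top
    have hd : im.1 + im.2 < d + 1 := Nat.lt_succ_of_le (hdeg im himT)
    have hπd : π im < d + 1 := Nat.lt_succ_of_le (hπ im himT)
    have hne := cmat_zero_ne_zero T κ π himT hk (fun im' him' he hπe => hinj im' him' im himT he hπe)
      (sigma_ne_zero hσ) d hd hπd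
    have h := monomial_lt_top d (cmat T κ π 0 σ d) W hWm K hKne δ ε hmono hfin' ⟨_, hd⟩ ⟨_, hπd⟩ hne
    exact ENNReal.mul_lt_top ENNReal.ofReal_lt_top h
  -- the piece is bounded by the sum of its absolute monomials
  have hpt : ∀ t ∈ Ioo (0 : ℝ) δ, ∀ v ∈ Ioo (0 : ℝ) ε,
      ENNReal.ofReal |usum Ti κ π t (0 + σ * v)| * W t v ≤
        ∑ im ∈ Ti, ENNReal.ofReal |κ im| * (ENNReal.ofReal (t ^ (im.1 + im.2) * v ^ (π im)) * W t v) := by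
    intro t ht v hv
    have h := abs_usum_le_sum κ π Ti hσ ht.1.le hv.1.le (t := t) (v := v)
    rw [zero_add]
    calc ENNReal.ofReal |usum Ti κ π t (σ * v)| * W t v
        ≤ ENNReal.ofReal (∑ im ∈ Ti, |κ im| * (t ^ (im.1 + im.2) * v ^ (π im))) * W t v :=
          mul_le_mul_left (ENNReal.ofReal_le_ofReal h) _
      _ = ∑ im ∈ Ti, ENNReal.ofReal |κ im| * (ENNReal.ofReal (t ^ (im.1 + im.2) * v ^ (π im)) * W t v) := by
          rw [ENNReal.ofReal_sum_of_nonneg (fun im _ => by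
            have := ht.1.le; have := hv.1.le; positivity), Finset.sum_mul]
          refine Finset.sum_congr rfl fun im _ => ?_
          rw [ENNReal.ofReal_mul (abs_nonneg _), mul_assoc]
  have hmeas : ∀ im ∈ Ti, Measurable (Function.uncurry fun t v => ENNReal.ofReal |κ im| *
      (ENNReal.ofReal (t ^ (im.1 + im.2) * v ^ (π im)) * W t v)) := by
    intro im _
    refine Measurable.const_mul ((ENNReal.measurable_ofReal.comp ?_).mul hWm) _
    exact (measurable_fst.pow_const _).mul (measurable_snd.pow_const _)
  calc ∫⁻ t in Ioo 0 δ, ∫⁻ v in Ioo 0 ε, ENNReal.ofReal |usum Ti κ π t (0 + σ * v)| * W t v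
      ≤ ∫⁻ t in Ioo 0 δ, ∫⁻ v in Ioo 0 ε, ∑ im ∈ Ti, ENNReal.ofReal |κ im| *
          (ENNReal.ofReal (t ^ (im.1 + im.2) * v ^ (π im)) * W t v) :=
        setLIntegral_mono' measurableSet_Ioo fun t ht =>
          setLIntegral_mono' measurableSet_Ioo fun v hv => hpt t ht v hv
    _ = ∑ im ∈ Ti, ∫⁻ t in Ioo 0 δ, ∫⁻ v in Ioo 0 ε, ENNReal.ofReal |κ im| *
          (ENNReal.ofReal (t ^ (im.1 + im.2) * v ^ (π im)) * W t v) :=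
        lintegral₂_finset_sum Ti _ hmeas _ _
    _ = ∑ im ∈ Ti, ENNReal.ofReal |κ im| * ∫⁻ t in Ioo 0 δ, ∫⁻ v in Ioo 0 ε,
          ENNReal.ofReal (t ^ (im.1 + im.2) * v ^ (π im)) * W t v := by
        refine Finset.sum_congr rfl fun im _ => ?_
        rw [← lintegral_const_mul' _ _ ENNReal.ofReal_ne_top]
        refine lintegral_congr fun t => ?_
        rw [← lintegral_const_mul' _ _ ENNReal.ofReal_ne_top]
    _ < ∞ := ENNReal.sum_lt_top.2 hmon

/-- **Ray theorem at the other directions through a point of the pole line (`s ≠ 0`).** -/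
theorem ray_pole_order (T : Finset (ℕ × ℕ)) (κ : ℕ × ℕ → ℝ) (π : ℕ × ℕ → ℕ) (d : ℕ)
    (hdeg : ∀ im ∈ T, im.1 + im.2 ≤ d) (hπ : ∀ im ∈ T, π im ≤ d)
    (hinj : ∀ im ∈ T, ∀ im' ∈ T, im.1 + im.2 = im'.1 + im'.2 → π im = π im' → im = im')
    (D M : ℕ) {s σ : ℝ} (hσ : |σ| = 1) (hs2 : |s| ≤ 2) (hs0 : s ≠ 0) {ω : ℝ → ℝ → ℝ}
    (hωm : Measurable (Function.uncurry ω)) {Λ' : ℝ → ℝ → ℝ≥0∞}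
    (hΛm : Measurable (Function.uncurry Λ')) {δ ε : ℝ} (hε : 0 < ε) (hδ1 : 4 * δ ≤ 1)
    (hε1 : 4 * ε ≤ 1) (hεs : 4 * ε ≤ |s| / 2) {ωlo ωhi : ℝ} (hωlo : 0 < ωlo)
    (hω : ∀ t ∈ Ioo (0 : ℝ) (4 * δ), ∀ v ∈ Ioo (0 : ℝ) (4 * ε), ωlo ≤ ω t v ∧ ω t v ≤ ωhi)
    (KΛ : ℝ≥0∞) (hKΛ : KΛ ≠ ∞)
    (hΛmono : ∀ x v x' v', 0 < x → x ≤ x' → x' ≤ 4 * x → x' < 4 * δ → 0 < v → v ≤ v' →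
      v' ≤ 4 * v → v' < 4 * ε → Λ' x v ≤ KΛ * Λ' x' v')
    (Kn : ℕ) (CΛ : ℝ≥0∞) (hCΛ : CΛ ≠ ∞)
    (hΛang : ∀ x, 0 < x → x < δ → ∀ v v', 0 < v → v ≤ v' → v' < ε →
      Λ' x v ≤ CΛ * ENNReal.ofReal ((1 + Real.log (v' / v)) ^ Kn) * Λ' x v')
    (hfin : ∫⁻ t in Ioo 0 (4 * δ), ∫⁻ v in Ioo 0 (4 * ε),
      ENNReal.ofReal |usum T κ π t (s + σ * v)| * wt D M s σ ω Λ' t v < ∞) (i : ℕ) :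
    ∫⁻ t in Ioo 0 δ, ∫⁻ v in Ioo 0 ε, ENNReal.ofReal |usum (T.filter fun im => im.1 = i) κ π t
      (s + σ * v)| * wt D M s σ ω Λ' t v < ∞ := by
  classical
  set W := wt D M s σ ω Λ' with hW
  have hWm : Measurable (Function.uncurry W) := measurable_wt D M s σ hωm hΛm
  have hmono := wt_mono D M hσ (Or.inr (Or.inr hεs)) hωlo hω KΛ hΛmono (Λ' := Λ')
  set K := ENNReal.ofReal (4 ^ D * 4 ^ M * (ωhi / ωlo)) * KΛ with hK
  have hKne : K ≠ ∞ := ENNReal.mul_ne_top ENNReal.ofReal_ne_top hKΛ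
  have hang := wt_ang D M hσ (Or.inr ⟨hs0, hεs⟩) hωlo hω Kn CΛ hΛang (Λ' := Λ')
  set C := ENNReal.ofReal (3 ^ M * (ωhi / ωlo)) * CΛ with hC
  have hCne : C ≠ ∞ := ENNReal.mul_ne_top ENNReal.ofReal_ne_top hCΛ
  have hfin' := hfin_cmat T κ π d hdeg hπ s σ W _ _ hfin
  set Ti := T.filter fun im => im.1 = i with hTi
  by_cases hne : ∃ im ∈ T, κ im ≠ 0
  swap
  · push Not at hne
    have h0 : ∀ t u, usum Ti κ π t u = 0 := fun t u =>
      Finset.sum_eq_zero fun im him => by rw [hne im (Finset.mem_filter.1 him).1]; ring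
    simp only [h0, abs_zero, ENNReal.ofReal_zero, zero_mul, lintegral_const, zero_mul]
    exact ENNReal.zero_lt_top
  obtain ⟨a₀, im₀, him₀, hk₀, ha₀, hmin⟩ := exists_order T κ hne
  have ha₀d : a₀ < d + 1 := by rw [← ha₀]; exact Nat.lt_succ_of_le (hdeg im₀ him₀)
  obtain ⟨b, hb⟩ := exists_cmat_ne_zero T κ π him₀ hk₀ ha₀
    (fun im him he hπe => hinj im him im₀ him₀ (he.trans ha₀.symm) hπe) (sigma_ne_zero hσ) d ha₀d hπ
  have hord := order_lt_top d (cmat T κ π s σ d) W hWm K hKne δ ε hε hmono Kn C hCne hang hfin'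
    ⟨a₀, ha₀d⟩ b hb
  -- the order bound for the piece
  set Cp := ∑ im ∈ Ti, |κ im| * 3 ^ (π im) with hCp
  have hCp0 : 0 ≤ Cp := Finset.sum_nonneg fun im _ => by positivity
  have hpt : ∀ t ∈ Ioo (0 : ℝ) δ, ∀ v ∈ Ioo (0 : ℝ) ε,
      ENNReal.ofReal |usum Ti κ π t (s + σ * v)| * W t v ≤
        ENNReal.ofReal Cp * (ENNReal.ofReal (t ^ a₀) * W t v) := by
    intro t ht v hv
    have hu : |s + σ * v| ≤ 3 := by
      calc |s + σ * v| ≤ |s| + |σ * v| := abs_add_le _ _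
        _ ≤ 2 + 1 := by
            rw [abs_mul, hσ, one_mul, abs_of_pos hv.1]
            linarith [hv.2]
        _ = 3 := by norm_num
    have h := abs_usum_le κ π Ti (fun im him hk => hmin im (Finset.mem_filter.1 him).1 hk) ht.1.le
      (by linarith [ht.2]) hu
    calc ENNReal.ofReal |usum Ti κ π t (s + σ * v)| * W t v
        ≤ ENNReal.ofReal (Cp * t ^ a₀) * W t v := mul_le_mul_left (ENNReal.ofReal_le_ofReal h) _
      _ = ENNReal.ofReal Cp * (ENNReal.ofReal (t ^ a₀) * W t v) := by
          rw [ENNReal.ofReal_mul hCp0, mul_assoc]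
  calc ∫⁻ t in Ioo 0 δ, ∫⁻ v in Ioo 0 ε, ENNReal.ofReal |usum Ti κ π t (s + σ * v)| * W t v
      ≤ ∫⁻ t in Ioo 0 δ, ∫⁻ v in Ioo 0 ε, ENNReal.ofReal Cp * (ENNReal.ofReal (t ^ a₀) * W t v) :=
        setLIntegral_mono' measurableSet_Ioo fun t ht =>
          setLIntegral_mono' measurableSet_Ioo fun v hv => hpt t ht v hv
    _ = ENNReal.ofReal Cp * ∫⁻ t in Ioo 0 δ, ∫⁻ v in Ioo 0 ε, ENNReal.ofReal (t ^ a₀) * W t v := by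
        rw [← lintegral_const_mul' _ _ ENNReal.ofReal_ne_top]
        refine lintegral_congr fun t => ?_
        rw [← lintegral_const_mul' _ _ ENNReal.ofReal_ne_top]
    _ < ∞ := ENNReal.mul_lt_top ENNReal.ofReal_lt_top hord

/-- **Ray theorem off the pole line: the weight is integrable near the corner.** -/
theorem ray_away (T : Finset (ℕ × ℕ)) (κ : ℕ × ℕ → ℝ) (π : ℕ × ℕ → ℕ) (d : ℕ)
    (hdeg : ∀ im ∈ T, im.1 + im.2 ≤ d) (hπ : ∀ im ∈ T, π im ≤ d)
    (hinj : ∀ im ∈ T, ∀ im' ∈ T, im.1 + im.2 = im'.1 + im'.2 → π im = π im' → im = im')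
    {s σ : ℝ} (hσ : |σ| = 1) {ω : ℝ → ℝ → ℝ} (hωm : Measurable (Function.uncurry ω))
    {Λ' : ℝ → ℝ → ℝ≥0∞} (hΛm : Measurable (Function.uncurry Λ')) {δ ε : ℝ} (hδ : 0 < δ)
    (hε : 0 < ε) {ωlo ωhi : ℝ} (hωlo : 0 < ωlo)
    (hω : ∀ t ∈ Ioo (0 : ℝ) (4 * δ), ∀ v ∈ Ioo (0 : ℝ) (4 * ε), ωlo ≤ ω t v ∧ ω t v ≤ ωhi)
    (KΛ : ℝ≥0∞) (hKΛ : KΛ ≠ ∞)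
    (hΛmono : ∀ x v x' v', 0 < x → x ≤ x' → x' ≤ 4 * x → x' < 4 * δ → 0 < v → v ≤ v' →
      v' ≤ 4 * v → v' < 4 * ε → Λ' x v ≤ KΛ * Λ' x' v')
    (Kn : ℕ) (CΛ : ℝ≥0∞) (hCΛ : CΛ ≠ ∞)
    (hΛang : ∀ x, 0 < x → x < δ → ∀ v v', 0 < v → v ≤ v' → v' < ε →
      Λ' x v ≤ CΛ * ENNReal.ofReal ((1 + Real.log (v' / v)) ^ Kn) * Λ' x v')
    (hΛrad : ∀ v, 0 < v → v < ε → ∀ x x', 0 < x → x ≤ x' → x' < δ →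
      Λ' x v ≤ CΛ * ENNReal.ofReal ((1 + Real.log (x' / x)) ^ Kn) * Λ' x' v)
    (hfin : ∫⁻ t in Ioo 0 (4 * δ), ∫⁻ v in Ioo 0 (4 * ε),
      ENNReal.ofReal |usum T κ π t (s + σ * v)| * wt 0 0 s σ ω Λ' t v < ∞)
    (hne : ∃ im ∈ T, κ im ≠ 0) :
    ∫⁻ t in Ioo 0 δ, ∫⁻ v in Ioo 0 ε, wt 0 0 s σ ω Λ' t v < ∞ := by
  classical
  set W := wt 0 0 s σ ω Λ' with hW
  have hWm : Measurable (Function.uncurry W) := measurable_wt 0 0 s σ hωm hΛm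
  have hmono := wt_mono 0 0 hσ (s := s) (Or.inl rfl) hωlo hω KΛ hΛmono (Λ' := Λ')
  set K := ENNReal.ofReal (4 ^ 0 * 4 ^ 0 * (ωhi / ωlo)) * KΛ with hK
  have hKne : K ≠ ∞ := ENNReal.mul_ne_top ENNReal.ofReal_ne_top hKΛ
  have hang := wt_ang 0 0 hσ (s := s) (Or.inl rfl) hωlo hω Kn CΛ hΛang (Λ' := Λ')
  have h3 : (3 : ℝ) ^ 0 * (ωhi / ωlo) = ωhi / ωlo := by ring
  rw [h3] at hang
  have hrad := wt_rad hωlo hω Kn CΛ hΛrad (s := s) (σ := σ)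
  set C := ENNReal.ofReal (ωhi / ωlo) * CΛ with hC
  have hCne : C ≠ ∞ := ENNReal.mul_ne_top ENNReal.ofReal_ne_top hCΛ
  have hfin' := hfin_cmat T κ π d hdeg hπ s σ W _ _ hfin
  obtain ⟨a₀, im₀, him₀, hk₀, ha₀, -⟩ := exists_order T κ hne
  have ha₀d : a₀ < d + 1 := by rw [← ha₀]; exact Nat.lt_succ_of_le (hdeg im₀ him₀)
  obtain ⟨b, hb⟩ := exists_cmat_ne_zero T κ π him₀ hk₀ ha₀
    (fun im him he hπe => hinj im him im₀ him₀ (he.trans ha₀.symm) hπe) (sigma_ne_zero hσ) d ha₀d hπ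
  exact mass_lt_top d (cmat T κ π s σ d) W hWm K hKne δ ε hδ hε hmono Kn C hCne hrad hang hfin'
    ⟨a₀, ha₀d⟩ b hb

end SepTwo

/-- **The Taylor pieces on a thin sector through a point of the pole line** (registered part of
`stub_separateTwoPos_hI`; literal form of `SepTwo.ray_pole_order`): for a ray of slope `s ≠ 0`,
`|s| ≤ 2`, if the double sum `F(t, u) = ∑ κ im t^{im.1+im.2} u^{π im}`, `u = s + σ v`, is absolutely
integrable against the weight `wt` on `(0, 4δ) × (0, 4ε)`, then every piece (the partial sum over
`im.1 = i`) is, on `(0, δ) × (0, ε)`. -/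
theorem separateTwo_hiRay (T : Finset (ℕ × ℕ)) (κ : ℕ × ℕ → ℝ) (π : ℕ × ℕ → ℕ) (d : ℕ) (hdeg : ∀ im ∈ T, im.1 + im.2 ≤ d) (hπ : ∀ im ∈ T, π im ≤ d) (hinj : ∀ im ∈ T, ∀ im' ∈ T, im.1 + im.2 = im'.1 + im'.2 → π im = π im' → im = im') (D M : ℕ) (s σ : ℝ) (hσ : |σ| = 1) (hs2 : |s| ≤ 2) (hs0 : s ≠ 0) (ω : ℝ → ℝ → ℝ) (hωm : Measurable (Function.uncurry ω)) (Λ' : ℝ → ℝ → ENNReal) (hΛm : Measurable (Function.uncurry Λ')) (δ ε : ℝ) (hε : 0 < ε) (hδ1 : 4 * δ ≤ 1) (hε1 : 4 * ε ≤ 1) (hεs : 4 * ε ≤ |s| / 2) (ωlo ωhi : ℝ) (hωlo : 0 < ωlo) (hω : ∀ t ∈ Set.Ioo (0 : ℝ) (4 * δ), ∀ v ∈ Set.Ioo (0 : ℝ) (4 * ε), ωlo ≤ ω t v ∧ ω t v ≤ ωhi) (KΛ : ENNReal) (hKΛ : KΛ ≠ ⊤) (hΛmono : ∀ x v x' v'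 : ℝ, 0 < x → x ≤ x' → x' ≤ 4 * x → x' < 4 * δ → 0 < v → v ≤ v' → v' ≤ 4 * v → v' < 4 * ε → Λ' x v ≤ KΛ * Λ' x' v') (Kn : ℕ) (CΛ : ENNReal) (hCΛ : CΛ ≠ ⊤) (hΛang : ∀ x : ℝ, 0 < x → x < δ → ∀ v v' : ℝ, 0 < v → v ≤ v' → v' < ε → Λ' x v ≤ CΛ * ENNReal.ofReal ((1 + Real.log (v' / v)) ^ Kn) * Λ' x v') (hfin : MeasureTheory.lintegral (MeasureTheory.volume.restrict (Set.Ioo 0 (4 * δ))) (fun t => MeasureTheory.lintegral (MeasureTheory.volume.restrict (Set.Ioo 0 (4 * ε))) (fun v => ENNReal.ofReal |SepTwo.usum T κ π t (s + σ * v)| * SepTwo.wt D M s σ ω Λ' t v)) < ⊤) (i : ℕ) : MeasureTheory.lintegral (MeasureTheory.volume.restrict (Set.Ioo 0 δ)) (fun t => MeasureTheory.lintegral (MeasureTheory.volume.restrict (Set.Ioo 0 ε)) (fun v => ENNReal.ofReal |SepTwo.usum (T.filter fun im => im.1 = i) κ π t (s + σ * v)| * SepTwo.wt D M s σ ω Λ'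 t v)) < ⊤ := by
  exact SepTwo.ray_pole_order T κ π d hdeg hπ hinj D M hσ hs2 hs0 hωm hΛm hε hδ1 hε1 hεs hωlo hω KΛ hKΛ hΛmono Kn CΛ hCΛ hΛang hfin i

end Summit.KontsevichZagierPeriods.ArrangementNormalForm.JanusBands
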